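import Mathlib
import Summits.NavierStokesRegularity.NavierStokesRegularity.Theorems.ThreadingFluxHorizonTowerDefs
import Summits.NavierStokesRegularity.NavierStokesRegularity.Theorems.ThreadingFluxHorizonTowerL2DegreeTwo
import HarnessLib

/-!
# Crux `PoloidalLiouville` (stmt-NavierStokesRegularity-1222, W1/W2), crux idea «linear-loop-law» (ns-idea-15 g3):
# K-alg₂ — QUADRATIC BRACKET RIGIDITY (`QuadraticBracketRigidity` of `Cruxes/PoloidalLiouville/LoopLawSketch.lean`), PROVED

Support file (`--supports stmt-NavierStokesRegularity-1222`, helper).  Experiment cell `ns-wall-extremal`, width hand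
ns-wall-eng-4 g3.  0 kit.  The sketch's statement is carried with its BODY VERBATIM, the sketch-local predicate
`IsTracelessSymmetric` being replaced by the Theorems-side `HorizonTower.IsShapeTensor` whose body is the same
(`(∀ a b, ⟪A a, b⟫ = ⟪a, A b⟫) ∧ tr A = 0`).

THE LEMMA (K-alg₂, the degree-2 case of same-degree bracket rigidity, in matrix form): two traceless symmetric
endomorphisms `A ≠ 0`, `B` of `ℝ³` whose loop bracket `det(y, Ay, By) = ⟪y, Ay × By⟫` vanishes identically are proportional,
`B = c A`.  PROOF (eigenbasis `b` of `A`, eigenvalues `α`, `Σα = 0`): for `y = bᵢ ± bⱼ`,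
`⟪y, Ay × By⟫ = ±(αⱼ − αᵢ) ⟪bᵢ × bⱼ, Bbᵢ ± Bbⱼ⟫`, so `αᵢ ≠ αⱼ ⇒ Bbᵢ, Bbⱼ ⊥ bᵢ × bⱼ = ±b_k`; since `A ≠ 0` is traceless its
eigenvalues are not all equal, and the three cases force `B` to be diagonal in `b`, `Bbᵢ = μᵢ bᵢ`; then `y = b₀ + b₁ + b₂` gives
`det(𝟙, α, μ) = 0`, which with `Σα = Σμ = 0` is `α₀μ₁ = α₁μ₀` (and cyclic), i.e. `μ = cα`.

HONEST FRAME: finite-dimensional linear algebra; the card's rungs (`PureDegreeShapeRigidity(OfBR)`, …) are not touched;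
`PoloidalLiouville` (1222), `UnthreadedRigidity` (27585) and NS regularity stay OPEN; W1/W2 movement 0.

## References
* planner ns-idea-15 g3, `Cruxes/PoloidalLiouville/LoopLawSketch.lean` (`QuadraticBracketRigidity`, K-alg₂).
-/

-- the summit and its single problem share the name (D-0017 nested layout)
set_option linter.dupNamespace false

noncomputable section

namespace Summit.NavierStokesRegularity.NavierStokesRegularity.Theorems.PoloidalLiouville.LoopLaw

open Set Function
open scoped RealInnerProductSpace
open Literature.Analysis.FluidPDE
open Summit.NavierStokesRegularity.NavierStokesRegularity.Theorems.PoloidalLiouville.HorizonTower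

/-- **K-alg₂ — QUADRATIC BRACKET RIGIDITY** (body of the sketch's `QuadraticBracketRigidity`, VERBATIM with
`IsTracelessSymmetric := HorizonTower.IsShapeTensor`): traceless symmetric `A ≠ 0`, `B` on `ℝ³` with `⟪y, Ay × By⟫ = 0` for all `y`
satisfy `B = c • A`. -/
theorem quadraticBracketRigidity :
    ∀ (A B : E3 →L[ℝ] E3), IsShapeTensor A → IsShapeTensor B → A ≠ 0 →
    (∀ y : E3, inner ℝ y (cross (A y) (B y)) = 0) → ∃ c : ℝ, B = c • A := by
  intro A B hA hB hA0 hdet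
  classical
  obtain ⟨hAs, hAtr⟩ := hA
  obtain ⟨hBs, hBtr⟩ := hB
  -- eigenbasis of `A`
  set T : E3 →ₗ[ℝ] E3 := (A : E3 →ₗ[ℝ] E3) with hT
  have hTs : T.IsSymmetric := fun u v => hAs u v
  have hn : Module.finrank ℝ E3 = 3 := finrank_euclideanSpace_fin
  set b : OrthonormalBasis (Fin 3) ℝ E3 := hTs.eigenvectorBasis hn with hb
  set α : Fin 3 → ℝ := hTs.eigenvalues hn with hα
  have hAb : ∀ i : Fin 3, A (b i) = α i • b i := fun i => by
    have h : T (b i) = (RCLike.ofReal (α i) : ℝ) • b i := hTs.apply_eigenvectorBasis hn i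
    simpa [hT] using h
  have hαsum : α 0 + α 1 + α 2 = 0 := by
    have h := hTs.trace_eq_sum_eigenvalues hn
    rw [Fin.sum_univ_three] at h
    have h' : LinearMap.trace ℝ E3 T = 0 := hAtr
    rw [h'] at h
    simpa [hα] using h.symm
  -- orthonormality bookkeeping
  have hbb : ∀ i j : Fin 3, ⟪b i, b j⟫ = if i = j then (1 : ℝ) else 0 := fun i j =>
    orthonormal_iff_ite.mp b.orthonormal i j
  -- expansion of any vector and of `B bⱼ`
  have hexp : ∀ v : E3, v = ⟪b 0, v⟫ • b 0 + ⟪b 1, v⟫ • b 1 + ⟪b 2, v⟫ • b 2 := fun v => by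
    conv_lhs => rw [← b.sum_repr' v]
    rw [Fin.sum_univ_three]
  set β : Fin 3 → Fin 3 → ℝ := fun i j => ⟪b i, B (b j)⟫ with hβ
  have hβs : ∀ i j, β i j = β j i := fun i j => by
    simp only [hβ]; rw [← hBs, real_inner_comm]
  -- cross-product algebra
  have cadd_l : ∀ u v w : E3, cross (u + v) w = cross u w + cross v w := fun u v w => by
    rw [← crossCLM_apply, map_add]; rfl
  have csmul_l : ∀ (c : ℝ) (u w : E3), cross (c • u) w = c • cross u w := fun c u w => by
    rw [← crossCLM_apply, map_smul]; rfl
  have cadd_r : ∀ u v w : E3, cross u (v + w) = cross u v + cross u w := fun u v w => by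
    rw [← crossCLM_apply, map_add]; rfl
  have csmul_r : ∀ (c : ℝ) (u w : E3), cross u (c • w) = c • cross u w := fun c u w => by
    rw [← crossCLM_apply, map_smul]; rfl
  have canti : ∀ u v : E3, cross v u = -cross u v := fun u v => by
    simp only [cross, ← cross_anticomm (WithLp.ofLp u) (WithLp.ofLp v), WithLp.toLp_neg]
  have cself : ∀ u : E3, cross u u = 0 := Tao2016.cross_self_eq_zero
  -- the basic triple product `σ = ⟪b₀, b₁ × b₂⟫` and the three normals
  set σ : ℝ := ⟪b 0, cross (b 1) (b 2)⟫ with hσ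
  have hn01 : cross (b 0) (b 1) = σ • b 2 := by
    have h0 : ⟪b 0, cross (b 0) (b 1)⟫ = 0 := Tao2016.inner_self_cross_left _ _
    have h1 : ⟪b 1, cross (b 0) (b 1)⟫ = 0 := Tao2016.inner_self_cross_right _ _
    have h2 : ⟪b 2, cross (b 0) (b 1)⟫ = σ := by
      rw [hσ, OrderTwo.inner_cross_cyclic (b 0) (b 1) (b 2), OrderTwo.inner_cross_cyclic (b 1) (b 2) (b 0)]
    rw [hexp (cross (b 0) (b 1)), h0, h1, h2, zero_smul, zero_smul, zero_add, zero_add]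
  have hn12 : cross (b 1) (b 2) = σ • b 0 := by
    have h0 : ⟪b 0, cross (b 1) (b 2)⟫ = σ := rfl
    have h1 : ⟪b 1, cross (b 1) (b 2)⟫ = 0 := Tao2016.inner_self_cross_left _ _
    have h2 : ⟪b 2, cross (b 1) (b 2)⟫ = 0 := Tao2016.inner_self_cross_right _ _
    rw [hexp (cross (b 1) (b 2)), h0, h1, h2, zero_smul, zero_smul, add_zero, add_zero]
  have hn02 : cross (b 0) (b 2) = (-σ) • b 1 := by
    have h0 : ⟪b 0, cross (b 0) (b 2)⟫ = 0 := Tao2016.inner_self_cross_left _ _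
    have h1 : ⟪b 1, cross (b 0) (b 2)⟫ = -σ := by
      rw [hσ, OrderTwo.inner_cross_cyclic (b 1) (b 0) (b 2), canti (b 1) (b 2), inner_neg_right]
    have h2 : ⟪b 2, cross (b 0) (b 2)⟫ = 0 := Tao2016.inner_self_cross_right _ _
    rw [hexp (cross (b 0) (b 2)), h0, h1, h2, zero_smul, zero_smul, zero_add, add_zero]
  have hσ0 : σ ≠ 0 := by
    -- `‖b₁ × b₂‖ = 1`
    have hang : InnerProductGeometry.angle (b 1) (b 2) = Real.pi / 2 := by
      rw [← InnerProductGeometry.inner_eq_zero_iff_angle_eq_pi_div_two, hbb 1 2]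
      simp
    have hnorm : ‖cross (b 1) (b 2)‖ = 1 := by
      rw [norm_cross, b.orthonormal.1 1, b.orthonormal.1 2, hang, Real.sin_pi_div_two]; ring
    intro h
    rw [hn12, h, zero_smul, norm_zero] at hnorm
    exact zero_ne_one hnorm
  -- the loop bracket on `bᵢ + t bⱼ`
  have hpair : ∀ (i j : Fin 3) (t : ℝ),
      ⟪b i + t • b j, cross (A (b i + t • b j)) (B (b i + t • b j))⟫
        = t * (α j - α i) * ⟪cross (b i) (b j), B (b i) + t • B (b j)⟫ := by
    intro i j t
    have hy : cross (b i + t • b j) (A (b i + t • b j)) = (t * (α j - α i)) • cross (b i) (b j) := by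
      rw [map_add, map_smul, hAb, hAb]
      simp only [cadd_l, cadd_r, csmul_l, csmul_r, cself, smul_zero, zero_add, add_zero]
      rw [canti (b i) (b j)]
      module
    rw [OrderTwo.inner_cross_cyclic, OrderTwo.inner_cross_cyclic, real_inner_comm, hy, real_inner_smul_left, map_add,
      map_smul]
  -- if `αᵢ ≠ αⱼ` then `Bbᵢ, Bbⱼ ⊥ bᵢ × bⱼ`
  have hP : ∀ i j : Fin 3, α i ≠ α j →
      ⟪cross (b i) (b j), B (b i)⟫ = 0 ∧ ⟪cross (b i) (b j), B (b j)⟫ = 0 := by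
    intro i j hij
    have h1 := hdet (b i + (1 : ℝ) • b j)
    have h2 := hdet (b i + (-1 : ℝ) • b j)
    rw [hpair] at h1 h2
    rw [one_smul, one_mul] at h1
    have hji : α j - α i ≠ 0 := sub_ne_zero.mpr (Ne.symm hij)
    have e1 : ⟪cross (b i) (b j), B (b i) + B (b j)⟫ = 0 := by
      rcases mul_eq_zero.mp h1 with h | h
      · exact absurd h hji
      · exact h
    have e2 : ⟪cross (b i) (b j), B (b i) + (-1 : ℝ) • B (b j)⟫ = 0 := by
      have : (-1 : ℝ) * (α j - α i) ≠ 0 := mul_ne_zero (by norm_num) hji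
      rcases mul_eq_zero.mp h2 with h | h
      · exact absurd h this
      · exact h
    rw [inner_add_right] at e1
    rw [inner_add_right, inner_smul_right] at e2
    constructor <;> linarith
  -- the three concrete pairs, as statements about the matrix `β`
  have hP01 : α 0 ≠ α 1 → β 2 0 = 0 ∧ β 2 1 = 0 := fun h => by
    obtain ⟨h1, h2⟩ := hP 0 1 h
    rw [hn01, real_inner_smul_left] at h1 h2
    exact ⟨(mul_eq_zero.mp h1).resolve_left hσ0, (mul_eq_zero.mp h2).resolve_left hσ0⟩
  have hP02 : α 0 ≠ α 2 → β 1 0 = 0 ∧ β 1 2 = 0 := fun h => by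
    obtain ⟨h1, h2⟩ := hP 0 2 h
    rw [hn02, real_inner_smul_left] at h1 h2
    have hσ0' : -σ ≠ 0 := neg_ne_zero.mpr hσ0
    exact ⟨(mul_eq_zero.mp h1).resolve_left hσ0', (mul_eq_zero.mp h2).resolve_left hσ0'⟩
  have hP12 : α 1 ≠ α 2 → β 0 1 = 0 ∧ β 0 2 = 0 := fun h => by
    obtain ⟨h1, h2⟩ := hP 1 2 h
    rw [hn12, real_inner_smul_left] at h1 h2
    exact ⟨(mul_eq_zero.mp h1).resolve_left hσ0, (mul_eq_zero.mp h2).resolve_left hσ0⟩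
  -- the eigenvalues of `A ≠ 0` (traceless) are not all equal
  have hne : ¬(α 0 = α 1 ∧ α 1 = α 2) := by
    rintro ⟨h01, h12⟩
    have h0 : α 0 = 0 := by linarith
    have hall : ∀ i, α i = 0 := by
      intro i; fin_cases i
      · exact h0
      · show α 1 = 0; linarith
      · show α 2 = 0; linarith
    apply hA0
    ext v
    rw [hexp v, map_add, map_add, map_smul, map_smul, map_smul, hAb, hAb, hAb, hall, hall, hall]
    simp
  -- hence `B` is diagonal in the eigenbasis
  have h10 : β 1 0 = 0 := by
    by_cases h02 : α 0 = α 2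
    · have h12 : α 1 ≠ α 2 := fun h => hne ⟨h02.trans h.symm, h⟩
      rw [hβs]; exact (hP12 h12).1
    · exact (hP02 h02).1
  have h20 : β 2 0 = 0 := by
    by_cases h01 : α 0 = α 1
    · have h12 : α 1 ≠ α 2 := fun h => hne ⟨h01, h⟩
      rw [hβs]; exact (hP12 h12).2
    · exact (hP01 h01).1
  have h21 : β 2 1 = 0 := by
    by_cases h01 : α 0 = α 1
    · have h02 : α 0 ≠ α 2 := fun h => hne ⟨h01, h01.symm.trans h⟩
      rw [hβs]; exact (hP02 h02).2
    · exact (hP01 h01).2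
  have h01 : β 0 1 = 0 := by rw [hβs]; exact h10
  have h02 : β 0 2 = 0 := by rw [hβs]; exact h20
  have h12 : β 1 2 = 0 := by rw [hβs]; exact h21
  have hBb : ∀ j : Fin 3, B (b j) = β j j • b j := by
    intro j
    rw [hexp (B (b j))]
    fin_cases j
    · show ⟪b 0, B (b 0)⟫ • b 0 + ⟪b 1, B (b 0)⟫ • b 1 + ⟪b 2, B (b 0)⟫ • b 2 = β 0 0 • b 0
      rw [show ⟪b 1, B (b 0)⟫ = β 1 0 from rfl, show ⟪b 2, B (b 0)⟫ = β 2 0 from rfl, h10, h20]; simp [hβ]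
    · show ⟪b 0, B (b 1)⟫ • b 0 + ⟪b 1, B (b 1)⟫ • b 1 + ⟪b 2, B (b 1)⟫ • b 2 = β 1 1 • b 1
      rw [show ⟪b 0, B (b 1)⟫ = β 0 1 from rfl, show ⟪b 2, B (b 1)⟫ = β 2 1 from rfl, h01, h21]; simp [hβ]
    · show ⟪b 0, B (b 2)⟫ • b 0 + ⟪b 1, B (b 2)⟫ • b 1 + ⟪b 2, B (b 2)⟫ • b 2 = β 2 2 • b 2
      rw [show ⟪b 0, B (b 2)⟫ = β 0 2 from rfl, show ⟪b 1, B (b 2)⟫ = β 1 2 from rfl, h02, h12]; simp [hβ]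
  set μ : Fin 3 → ℝ := fun i => β i i with hμ
  have hBb' : ∀ j : Fin 3, B (b j) = μ j • b j := hBb
  -- `tr B = Σ μ`
  have hμsum : μ 0 + μ 1 + μ 2 = 0 := by
    have h : LinearMap.trace ℝ E3 (B : E3 →ₗ[ℝ] E3) = ∑ i, ⟪b i, (B : E3 →ₗ[ℝ] E3) (b i)⟫ :=
      LinearMap.trace_eq_sum_inner _ b
    rw [hBtr, Fin.sum_univ_three] at h
    simp only [ContinuousLinearMap.coe_coe] at h
    simp only [hμ, hβ]
    linarith
  -- the bracket at `y = b₀ + b₁ + b₂`: `det(𝟙, α, μ) = 0`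
  have hD : (α 1 - α 0) * μ 2 - (α 2 - α 0) * μ 1 + (α 2 - α 1) * μ 0 = 0 := by
    have h := hdet (b 0 + b 1 + b 2)
    have hAy : A (b 0 + b 1 + b 2) = α 0 • b 0 + α 1 • b 1 + α 2 • b 2 := by
      rw [map_add, map_add, hAb, hAb, hAb]
    have hBy : B (b 0 + b 1 + b 2) = μ 0 • b 0 + μ 1 • b 1 + μ 2 • b 2 := by
      rw [map_add, map_add, hBb', hBb', hBb']
    have hy : cross (b 0 + b 1 + b 2) (A (b 0 + b 1 + b 2))
        = ((α 1 - α 0) * σ) • b 2 + (-((α 2 - α 0) * σ)) • b 1 + ((α 2 - α 1) * σ) • b 0 := by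
      rw [hAy]
      simp only [cadd_l, cadd_r, csmul_r, cself, smul_zero, zero_add, add_zero]
      rw [canti (b 0) (b 1), canti (b 0) (b 2), canti (b 1) (b 2), hn01, hn02, hn12]
      module
    rw [OrderTwo.inner_cross_cyclic, OrderTwo.inner_cross_cyclic, real_inner_comm, hy, hBy] at h
    simp only [inner_add_left, inner_add_right, real_inner_smul_left, real_inner_smul_right, hbb] at h
    simp only [Fin.isValue, Fin.reduceEq, ↓reduceIte, one_ne_zero] at h
    have h' : σ * ((α 1 - α 0) * μ 2 - (α 2 - α 0) * μ 1 + (α 2 - α 1) * μ 0) = 0 := by linear_combination h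
    exact (mul_eq_zero.mp h').resolve_left hσ0
  -- `μ` is proportional to `α`
  have hmin01 : α 0 * μ 1 = α 1 * μ 0 := by
    have hα2 : α 2 = -α 0 - α 1 := by linarith
    have hμ2 : μ 2 = -μ 0 - μ 1 := by linarith
    rw [hα2, hμ2] at hD
    linarith
  have hmin02 : α 0 * μ 2 = α 2 * μ 0 := by
    have hα2 : α 2 = -α 0 - α 1 := by linarith
    have hμ2 : μ 2 = -μ 0 - μ 1 := by linarith
    rw [hα2, hμ2]; linarith
  have hmin12 : α 1 * μ 2 = α 2 * μ 1 := by
    have hα2 : α 2 = -α 0 - α 1 := by linarith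
    have hμ2 : μ 2 = -μ 0 - μ 1 := by linarith
    rw [hα2, hμ2]; linarith
  -- `μ = c α`
  have hprop : ∃ c : ℝ, μ 0 = c * α 0 ∧ μ 1 = c * α 1 ∧ μ 2 = c * α 2 := by
    by_cases h0 : α 0 = 0
    · by_cases h1 : α 1 = 0
      · exact absurd ⟨by rw [h0, h1], by linarith⟩ hne
      · refine ⟨μ 1 / α 1, ?_, ?_, ?_⟩
        · rw [div_mul_eq_mul_div, eq_div_iff h1]; linear_combination (-1 : ℝ) * hmin01
        · rw [div_mul_eq_mul_div, eq_div_iff h1]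
        · rw [div_mul_eq_mul_div, eq_div_iff h1]; linear_combination hmin12
    · refine ⟨μ 0 / α 0, ?_, ?_, ?_⟩
      · rw [div_mul_eq_mul_div, eq_div_iff h0]
      · rw [div_mul_eq_mul_div, eq_div_iff h0]; linear_combination hmin01
      · rw [div_mul_eq_mul_div, eq_div_iff h0]; linear_combination hmin02
  obtain ⟨c, hc0, hc1, hc2⟩ := hprop
  refine ⟨c, ?_⟩
  refine ContinuousLinearMap.ext fun v => ?_
  have hBv : B v = ⟪b 0, v⟫ • B (b 0) + ⟪b 1, v⟫ • B (b 1) + ⟪b 2, v⟫ • B (b 2) := by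
    conv_lhs => rw [hexp v]
    rw [map_add, map_add, map_smul, map_smul, map_smul]
  have hAv : A v = ⟪b 0, v⟫ • A (b 0) + ⟪b 1, v⟫ • A (b 1) + ⟪b 2, v⟫ • A (b 2) := by
    conv_lhs => rw [hexp v]
    rw [map_add, map_add, map_smul, map_smul, map_smul]
  show B v = c • A v
  rw [hBv, hAv, hBb', hBb', hBb', hAb, hAb, hAb, hc0, hc1, hc2]
  module

end Summit.NavierStokesRegularity.NavierStokesRegularity.Theorems.PoloidalLiouville.LoopLaw

end
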